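import Summits.Langlands.Langlands.Theorems.IrreducibilityBySelfDualityReciprocityUpToIrreducibilityArtinLocalGlobal
import HarnessLib

/-!
# Line `Sketch` for the crux `ReciprocityUpToIrreducibility` (item stmt-Langlands-14328), wave N10-G:
# tightness above `ℓ` after D1 — the crux DECIDES the Weil–Deligne normalisation of the pinned datum
# on rank-one Artin characters, relative to its own `Rec`

Support file (closes nothing; registered stub `stub_crux_decides_wd_rankOne` of the checked skeleton
`Lines/Sketch.lean`, wave N10 of continuation lead c8, prover-line-stmt-Langlands-14328-c8-0).

Since D1 (the period ring of the pinned datum `fontainePstAdicCompletion v ℓ hv` IS `B_dR(K_v)`) the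
only thing the pinned datum does not decide on Artin-type representations above `ℓ` is the
NORMALISATION of the Weil–Deligne representations it attaches (`PstWeilDeligneData.IsWeilDeligneOf`).
This file records, kernel-checked, that the crux `E = ReciprocityUpToIrreducibility` decides it on the
rank-one Artin sector, relative to the reciprocity datum `Rec` that `E` provides: for a finite-order Hecke
character `θ` with Artin character `ψ` (`ψ` unramified exactly where `θ` is, `ψ(Frob_v) = θ(ϖ_v)` there),
at every `v ∣ ℓ`, EVERY Weil–Deligne representation `r` the pinned datum attaches to the localisation of
the `ℓ`-adic avatar `ι⁻¹ψ⁻¹` of `ψ` has `N = 0` and `r.ρ(w) = ι⁻¹(θ_v((Rec.llc v).artin w)) • id` — the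
post-D1 form of "what the crux adds over the specification at `v ∣ ℓ`" (the disprover's
`Negative/PinnedFontaineDatumUndecided` is the case `θ = 1`).

Proof.  Direction (A') of `E` at `n = 1` for the cuspidal model `π_θ = ℂ·(θ ∘ det)/⊥`
(`stub_rankOne_cuspidalModel_of_isFiniteOrder`) yields `ρ` with `Corresponds Rec ι π_θ ρ`; the avatar is
Satake–Frobenius compatible with `π_θ` at the cofinitely many unramified places of `θ`
(`satakeFrobCompatibleAt_model_of_hasFrobCharpolyAt`), so `ρ` is conjugate to the avatar (Chebotarev,
`isConjugate_of_satakeFrobCompatibleAt`), i.e. EQUAL to it (`conj_eq_self_of_rank_one`).  The clause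
`LocalGlobalCompatibleAt Rec ι π_θ ρ v` at `v ∣ ℓ` provides `(π_v, r₀, rℂ)`: `r₀` attached to
`ρ|_{Γ_{K_v}}` by the pinned datum (`Rec.pst ℓ v hv` is `fontainePstAdicCompletion v ℓ hv` by `rfl`),
`rℂ = ι(r₀)` of class `rec_v(π_v)`.  The given `r` is attached to the same representation, hence
`r ≅ r₀` (`PstWeilDeligneData.isEquivalent`), so a transport `rℂ'` of `r` along `ι`
(`exists_isTransportAlong`) is `≅ rℂ` (`isEquivalent_of_isTransportAlong`) and inherits the class
(`hasFrobSemisimpleClass_of_isEquivalent`); any local component acts through `θ_v ∘ det` (S-E,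
`localComponent_ρ_apply_eq_of_hasLocalComponentAt`), so that class is `rec_v[θ_v ∘ det]`
(`IsLocalLanglandsGL.rec_one_mk`) and `rℂ'` has `N = 0`, `rℂ'.ρ(w) = θ_v(artin_v w) • id` (S-F,
`N_eq_zero_and_forall_of_hasFrobSemisimpleClass_recGL_one`); pulling back along the transport in rank
one (`N_eq_zero_of_isTransportAlong_wdBridge`, `ρ_eq_symm_smul_id_of_isTransportAlong_fin_one`: on the
line every endomorphism is a scalar, and `ι` is injective) gives the claim for `r`.

* `ρ_eq_symm_smul_id_of_isTransportAlong_fin_one` — rank-one pull-back of a scalar along a transport.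
* `wd_of_rankOne_localGlobalCompatibleAt_above` — the local unpacking at `v ∣ ℓ` for a `GL₁` datum acted
  on through `θ ∘ det` and ANY `ρ`, `Rec` (the `θ`-version of the disprover's
  `isWeilDeligneOf_trivial_of_localGlobalCompatibleAt`).
* `wd_lAdicAvatar_of_automorphicToGalois_glOne` — the open form: the (A')-conjunct of the crux body at
  `n = 1` for `Rec` decides the normalisation on the avatar of every finite-order `θ`.
* `stub_crux_decides_wd_rankOne` — the registered stub (closed form, `E` as antecedent).

A TIGHTNESS theorem (the crux is the antecedent); no definitions; std axioms; no named fact assumed.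
-/

noncomputable section

set_option linter.dupNamespace false -- project-wide option (lakefile weak.linter.dupNamespace); `Summit.Langlands.Langlands` is the mandated namespace

open scoped MatrixGroups Matrix NumberField Classical Polynomial
open Filter IsDedekindDomain Field Polynomial
open Literature.NumberTheory.Automorphic Literature.NumberTheory.GaloisRepresentations
open Literature.NumberTheory.PAdicHodge
open Summit.Langlands
open Summit.Langlands.Langlands.Theorems.IrreducibleOffSector

namespace Summit.Langlands.Langlands.Theorems.ReciprocityUpToIrreducibility

/-! ## 1. Local: rank-one pull-back of scalars along a transport `ι` -/

section Local

variable {F : Type} [Field F] [ValuativeRel F] [TopologicalSpace F] [IsNonarchimedeanLocalField F]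
  {E : Type*} [Field E] [CharZero E] {C : Type*} [Field C] [CharZero C]

/-- **Rank one: a transport along `ι : E ≃+* C` acting at `w` by the scalar `c` comes from the scalar
`ι⁻¹ c`.**  If `r'` on `Fin 1 → C` is `r` on `Fin 1 → E` transported along `ι` (`IsTransportAlong`: the
matrix of `r'.ρ w` is the entrywise `ι`-image of that of `r.ρ w`) and `r'.ρ w = c • id`, then
`r.ρ w = ι⁻¹(c) • id`: on the line `r.ρ w = a • id` for some `a`
(`Module.End.exists_eq_smul_id_of_finrank_eq_one`), and the `(0,0)` entries give `c = ι a`.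
[cite: DeligneAntwerpII1973, §8.4.3] [cite: TateCorvallis1979, (4.1.3)] -/
theorem ρ_eq_symm_smul_id_of_isTransportAlong_fin_one (ι : E ≃+* C)
    {r : WeilDeligneRep F E (Fin 1 → E)} {r' : WeilDeligneRep F C (Fin 1 → C)}
    (hT : r.IsTransportAlong (ι : E →+* C) r') {w : WeilGroup F} {c : C}
    (h : r'.ρ w = c • LinearMap.id) : r.ρ w = ι.symm c • LinearMap.id := by
  obtain ⟨a, ha⟩ :=
    Module.End.exists_eq_smul_id_of_finrank_eq_one (Module.finrank_fin_fun E) (r.ρ w)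
  have h1 : LinearMap.toMatrix' (r'.ρ w) 0 0 = c := by
    rw [h, map_smul, LinearMap.toMatrix'_id, Matrix.smul_apply, Matrix.one_apply_eq, smul_eq_mul,
      mul_one]
  have h2 : LinearMap.toMatrix' (r.ρ w) 0 0 = a := by
    rw [ha, map_smul, LinearMap.toMatrix'_id, Matrix.smul_apply, Matrix.one_apply_eq, smul_eq_mul,
      mul_one]
  have hmat := congr_fun (congr_fun (hT.1 w) 0) 0
  rw [Matrix.map_apply, h1, h2] at hmat
  -- `hmat : c = ι a`
  rw [ha, hmat]
  congr 1
  exact (ι.symm_apply_apply a).symm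

end Local

/-! ## 2. Global, rank one at `v ∣ ℓ`: the clause pins every attached Weil–Deligne representation -/

section Summit

variable {K : Type} [Field K] [NumberField K] {ℓ : ℕ} [Fact ℓ.Prime]
  {hcpt : isCompact_glFiniteIntegralLevel 1 K}

/-- **Local unpacking at `v ∣ ℓ` (rank one, any `Rec`, any `ρ`).**  Let `GL₁(𝔸_K)` act on `π = W/W'`
through `θ ∘ det` modulo `W'`, and suppose `LocalGlobalCompatibleAt Rec ι π ρ v` at a place `v ∣ ℓ`.
Then EVERY Weil–Deligne representation `r` that the pinned datum `fontainePstAdicCompletion v ℓ hv`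
attaches to `ρ|_{Γ_{K_v}}` has `N = 0` and acts at `w ∈ W_{K_v}` by the scalar
`ι⁻¹(θ_v((Rec.llc v).artin w))`: the clause's attached `r₀` is `≅ r` (uniqueness field
`PstWeilDeligneData.isEquivalent`; `Rec.pst ℓ v hv` is the pinned datum by `rfl`), so a transport of `r`
along `ι` is `≅ ι(r₀)` and has class `rec_v(π_v) = rec_v[θ_v ∘ det]` (any local component acts through
`θ_v ∘ det`, S-E; `IsLocalLanglandsGL.rec_one_mk`), which on the line pins `N = 0` and the scalars
`θ_v(artin_v w)` (S-F); pull back along the transport (rank one).  The case `θ = 1` is the disprover's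
`isWeilDeligneOf_trivial_of_localGlobalCompatibleAt`.
[cite: TateCorvallis1979, (4.1.3)–(4.2.1)] [cite: FontaineAsterisque223VIII, §2.3.7]
[cite: HarrisTaylorAMS2001, Thm. A (i)] [cite: FlathCorvallis1979, Thm. 3] -/
theorem wd_of_rankOne_localGlobalCompatibleAt_above
    (Rec : ReciprocityData K) (ι : PadicAlgCl ℓ ≃+* ℂ)
    (π : AutomorphicRepData (AutomorphyDatum.gl 1 K hcpt)) (θ : HeckeCharacter K)
    (hact : ∀ (g : (AdelicGroupData.gl 1 K).Adelic), ∀ φ ∈ π.W,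
      rightTranslation (AdelicGroupData.gl 1 K) g φ -
        ((θ (Matrix.GeneralLinearGroup.det g) : ℂˣ) : ℂ) • φ ∈ π.W')
    (ρ : FramedGaloisRep K (PadicAlgCl ℓ) 1) {v : HeightOneSpectrum (𝓞 K)}
    (h : LocalGlobalCompatibleAt Rec ι π ρ v) (hv : ((ℓ : ℕ) : 𝓞 K) ∈ v.asIdeal)
    {r : WeilDeligneRep (v.adicCompletion K) (PadicAlgCl ℓ) (Fin 1 → PadicAlgCl ℓ)}
    (hr : (fontainePstAdicCompletion v ℓ hv).IsWeilDeligneOf (ρ.toLocal v) r) :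
    r.N = 0 ∧ ∀ w : WeilGroup (v.adicCompletion K),
      r.ρ w = (ι.symm ((θ.localComponent v ((Rec.llc v).artin.artin w) : ℂˣ) : ℂ)) • LinearMap.id := by
  obtain ⟨πv, r₀, rℂ, hloc, -, hpst, htr, hcls⟩ := h
  -- `r ≅ r₀`: both are attached to `ρ|_{Γ_{K_v}}` by the pinned datum
  have heq : r.IsEquivalent r₀ := (fontainePstAdicCompletion v ℓ hv).isEquivalent _ r r₀ hr (hpst hv)
  -- a transport `rℂ'` of `r` along `ι` is `≅ rℂ` and inherits the class `rec_v(π_v)`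
  obtain ⟨rℂ', htr'⟩ := exists_isTransportAlong (ι : PadicAlgCl ℓ →+* ℂ) r
  have hcls₁ : rℂ'.HasFrobSemisimpleClass ((Rec.llc v).recGL 1 (IrrClass.mk πv)) :=
    hasFrobSemisimpleClass_of_isEquivalent (isEquivalent_of_isTransportAlong _ heq.symm htr htr') hcls
  -- any local component acts through `θ_v ∘ det`, so `rec_v(π_v) = rec_v(θ_v ∘ det)`
  obtain ⟨θv, hθv⟩ := exists_quasiChar_eq_localComponent θ v
  have hπv : ∀ (g : GL (Fin 1) (v.adicCompletion K)) (x : πv.V),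
      πv.ρ g x = ((θv (Matrix.GeneralLinearGroup.det g) : ℂˣ) : ℂ) • x := fun g x => by
    rw [localComponent_ρ_apply_eq_of_hasLocalComponentAt π θ hact v πv hloc g x, hθv]
  have hcls' : rℂ'.HasFrobSemisimpleClass
      ((Rec.llc v).recGL 1 (IrrClass.mk (SmoothIrrep.ofQuasiChar θv))) := by
    rw [(Rec.llc v).isLocalLanglands.rec_one_mk (SmoothIrrep.ofQuasiChar_ρ_apply θv),
      ← (Rec.llc v).isLocalLanglands.rec_one_mk hπv]
    exact hcls₁
  -- S-F on the line: `rℂ'.N = 0`, `rℂ'.ρ w = θ_v(artin_v w) • id`; pull back along `ι`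
  obtain ⟨hN', hρ'⟩ := N_eq_zero_and_forall_of_hasFrobSemisimpleClass_recGL_one (Rec.llc v) hcls'
  refine ⟨N_eq_zero_of_isTransportAlong_wdBridge _ htr' hN', fun w => ?_⟩
  rw [← hθv]
  exact ρ_eq_symm_smul_id_of_isTransportAlong_fin_one ι htr' (hρ' w)

/-- **Open form: the (A')-conjunct of the crux body at `n = 1` decides the Weil–Deligne normalisation of
the pinned datum on rank-one Artin characters, relative to `Rec`.**  Suppose every L-algebraic cuspidal
`π` of `GL₁(𝔸_K)` has, for all `ℓ, ι`, some `ρ` with `Corresponds Rec ι π ρ` (geometricity is not used).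
Let `θ` be a finite-order Hecke character and `ψ` a rank-one Artin representation unramified exactly
where `θ` is, with `ψ(Frob_v^{arith}) = θ(ϖ_v)` there.  Then at every `v ∣ ℓ`, every Weil–Deligne
representation `r` the pinned datum attaches to the localisation of the `ℓ`-adic avatar of `ψ` has
`N = 0` and `r.ρ(w) = ι⁻¹(θ_v((Rec.llc v).artin w)) • id`: the `ρ` attached to the cuspidal model
`π_θ = ℂ·(θ ∘ det)/⊥` (`stub_rankOne_cuspidalModel_of_isFiniteOrder`) is conjugate to the avatar
(Satake–Frobenius compatibility of both at the cofinitely many unramified places of `θ`, Chebotarev: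
`isConjugate_of_satakeFrobCompatibleAt`), hence equal to it (`conj_eq_self_of_rank_one`), and the clause
at `v` pins every attached `r` (`wd_of_rankOne_localGlobalCompatibleAt_above`).
[cite: TateCorvallis1979, (4.1.3)–(4.2.1)] [cite: FontaineAsterisque223VIII, §2.3.7]
[cite: DeligneSerreASENS1974, Lemme 3.2] -/
theorem wd_lAdicAvatar_of_automorphicToGalois_glOne (Rec : ReciprocityData K)
    (hA : ∀ π : CuspidalAutomorphicRepData 1 K hcpt, π.1.IsLAlgebraic →
      ∀ (ℓ : ℕ) [Fact ℓ.Prime] (ι : PadicAlgCl ℓ ≃+* ℂ),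
        ∃ ρ : FramedGaloisRep K (PadicAlgCl ℓ) 1, IsGeometricFramed Rec ρ ∧ Corresponds Rec ι π.1 ρ)
    (ι : PadicAlgCl ℓ ≃+* ℂ) {θ : HeckeCharacter K} (hfin : θ.IsFiniteOrder) {ψ : FramedArtinRep K 1}
    (hram : ∀ v : HeightOneSpectrum (𝓞 K), ψ.IsUnramifiedAt v ↔ θ.IsUnramifiedAt v)
    (hfrob : ∀ v : HeightOneSpectrum (𝓞 K), θ.IsUnramifiedAt v →
      ψ.HasFrobCharpolyAt v (X - C (θ.valueAtUniformizer v)))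
    {v : HeightOneSpectrum (𝓞 K)} (hv : ((ℓ : ℕ) : 𝓞 K) ∈ v.asIdeal)
    {r : WeilDeligneRep (v.adicCompletion K) (PadicAlgCl ℓ) (Fin 1 → PadicAlgCl ℓ)}
    (hr : (fontainePstAdicCompletion v ℓ hv).IsWeilDeligneOf ((ψ.lAdicAvatar ι).toLocal v) r) :
    r.N = 0 ∧ ∀ w : WeilGroup (v.adicCompletion K),
      r.ρ w = (ι.symm ((θ.localComponent v ((Rec.llc v).artin.artin w) : ℂˣ) : ℂ)) • LinearMap.id := by
  obtain ⟨π, hW, hW', hL⟩ := stub_rankOne_cuspidalModel_of_isFiniteOrder K hcpt θ hfin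
  obtain ⟨ρ, -, hcorr⟩ := hA π hL ℓ ι
  -- the avatar is Satake–Frobenius compatible with `π_θ` at the unramified places of `θ`
  have hρ : ∀ v : HeightOneSpectrum (𝓞 K), θ.IsUnramifiedAt v →
      (ψ.lAdicAvatar ι).IsUnramifiedAt v ∧
        (ψ.lAdicAvatar ι).HasFrobCharpolyAt v (X - C (ι.symm (θ.valueAtUniformizer v)⁻¹)) :=
    fun v hv => ⟨(ψ.isUnramifiedAt_lAdicAvatar_iff ι v).mpr ((hram v).mpr hv),
      ψ.hasFrobCharpolyAt_lAdicAvatar ι (hfrob v hv)⟩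
  have hcof : ∀ᶠ v : HeightOneSpectrum (𝓞 K) in cofinite, θ.IsUnramifiedAt v :=
    HeckeCharacter.isUnramifiedAt_cofinite_holds θ
  have hsat : ∀ᶠ v : HeightOneSpectrum (𝓞 K) in cofinite,
      SatakeFrobCompatibleAt ι π.1 (ψ.lAdicAvatar ι) v :=
    hcof.mono fun v hv =>
      satakeFrobCompatibleAt_model_of_hasFrobCharpolyAt ι hW hW' (ψ.lAdicAvatar ι) hv (hρ v hv).1
        (hρ v hv).2
  -- so `ρ` is conjugate, hence (rank one) equal, to the avatar
  obtain ⟨g, hg⟩ :=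
    isConjugate_of_satakeFrobCompatibleAt π.1 ι (isIrreducible_of_rank_one ρ) hcorr.1 hsat
  rw [conj_eq_self_of_rank_one] at hg
  subst hg
  exact wd_of_rankOne_localGlobalCompatibleAt_above Rec ι π.1 θ (smul_char_of_detTwist_model hW) _
    (hcorr.2 v) hv hr

end Summit

/-- **stub N10-G (tightness above `ℓ` after D1; registered): the crux DECIDES the Weil–Deligne normalisation of the pinned
datum on rank-one Artin characters, relative to its own `Rec`.**  If `E` holds then, for the reciprocity datum `Rec` it
provides, at every `v ∣ ℓ` every Weil–Deligne representation the pinned datum attaches to the localisation of the `ℓ`-adic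
avatar of the Artin character `ψ` of a finite-order Hecke character `θ` is the character `w ↦ ι⁻¹(θ_v((Rec.llc v).artin w))`
with `N = 0` — the post-D1 form of "what the crux adds over the specification at `v ∣ ℓ`" (cf. the disprover's
`Negative/PinnedFontaineDatumUndecided`, whose pair `(π_𝟙, 1)` is the case `θ = 1`): by (A)₁ at `π_θ` the correspondent is
the avatar (Chebotarev), and the clause at `v` pins the attached class to `rec_v(θ_v ∘ det) = [θ_v ∘ artin_v]`.
Closed form of `wd_lAdicAvatar_of_automorphicToGalois_glOne` with `Rec` the datum of `E K` and
`hcpt := isCompact_glFiniteIntegralLevel_holds 1 K`.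
[cite: TateCorvallis1979, (4.1.3)–(4.2.1)] [cite: FontaineAsterisque223VIII, §2.3.7] -/
theorem stub_crux_decides_wd_rankOne :
    Summit.Langlands.Langlands.Theses.IrreducibilityBySelfDuality.ReciprocityUpToIrreducibility →
    ∀ (K : Type) [Field K] [NumberField K], ∃ Rec : ReciprocityData K,
      ∀ (ℓ : ℕ) [Fact ℓ.Prime] (ι : PadicAlgCl ℓ ≃+* ℂ) (θ : HeckeCharacter K), θ.IsFiniteOrder →
      ∀ (ψ : FramedArtinRep K 1),
        (∀ v : HeightOneSpectrum (𝓞 K), ψ.IsUnramifiedAt v ↔ θ.IsUnramifiedAt v) →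
        (∀ v : HeightOneSpectrum (𝓞 K), θ.IsUnramifiedAt v →
          ψ.HasFrobCharpolyAt v (X - C (θ.valueAtUniformizer v))) →
        ∀ (v : HeightOneSpectrum (𝓞 K)) (hv : ((ℓ : ℕ) : 𝓞 K) ∈ v.asIdeal)
          (r : WeilDeligneRep (v.adicCompletion K) (PadicAlgCl ℓ) (Fin 1 → PadicAlgCl ℓ)),
          (Literature.NumberTheory.PAdicHodge.fontainePstAdicCompletion v ℓ hv).IsWeilDeligneOf
              ((ψ.lAdicAvatar ι).toLocal v) r →
            r.N = 0 ∧ ∀ w : WeilGroup (v.adicCompletion K),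
              r.ρ w = (ι.symm ((θ.localComponent v ((Rec.llc v).artin.artin w) : ℂˣ) : ℂ)) • LinearMap.id := by
  intro hE K _ _
  obtain ⟨Rec, hRec⟩ := hE K
  exact ⟨Rec, fun ℓ _ ι θ hfin ψ hram hfrob v hv r hr =>
    wd_lAdicAvatar_of_automorphicToGalois_glOne Rec
      (hRec 1 one_pos (isCompact_glFiniteIntegralLevel_holds 1 K)).1 ι hfin hram hfrob hv hr⟩

end Summit.Langlands.Langlands.Theorems.ReciprocityUpToIrreducibility

end
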